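import Summits.QuantumFields.BalabanUV.T4Continuum.Spine.NE3.PairLandauB8
import Literature.MathematicalPhysics.QuantumFieldTheory.Balaban1983to89.B7Eq92Concrete
import HarnessLib

/-!
# T⁴ programme, node NE3 — REPAIR R3∕R24: [Balaban1985RegularSpaces] THEOREM 2 AT THE PAIR WITH THE CLAUSE (1.37) «Q_k(U₀, ηA) = B» (B = 0 at the
# pair by (1.31)), typed in the tree's vocabulary through the b07 lineage's DOUBLE-BAR average `B7Eq92Concrete.dbavgCovIter`, AND B8's TANGENT SLICE
# `slicB8` (Landau (1.38) ∧ kernel of the linearised double-bar average `QbarIter`) — statement-first; hypothesis SHAPES asserted for nothing except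
# the flat datum

Cell `pub-balaban-gaps` (YM blitz, track G2, seat `ne3`, unit `pub-balaban-gaps-ne3`; writer prover-pub-balaban-gaps-ne3-g2-0, 2026-08-22), companion of
`Spine/NE3/PairLandauB8` (p340877: `LandauRepB8`, `PairLandauGaugeB8`, `IsLandauB8`, the junction `ne3EnergyRateWCov_of_pairLandauGaugeB8`), census
`run/shared/lean/pub/pub-balaban-gaps/ne/NE3.md` §4 R24 (i): the chart supplier on B8's surface needs the NON-LINEAR double-bar fibre equation of the
representative, i.e. Thm 2's conclusion (1.37), which `LandauRepB8` does not carry.  Inputs BY NAME: `B7Eq92Concrete.{Rc, expUnit_conj, tHol, Fcov,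
wframe, tild, dbavgCov, dbavgCovIter}` ([Balaban1985Averaging] (55)–(58), (82), (65), (89)–(91) on the lineage's `ℤᵈ` carriers, polymorphic in the
bond algebra — here `Matrix n n ℂ`), `NE3TangentCovariantTower.QbarIter` (the k-fold LINEARISED double-bar average, [Balaban1985Averaging] (120)),
`T4AveragingDeficitWall.{vary, Ad}`.

WHAT IS PRINTED (verbatim).  [Balaban1985RegularSpaces] (1.37) p. 82: «Q_j(U₀, ηA) = B on Λ_j, j = 0, 1, …, k, B is given by formula (1.31) with V′ = Ũ′ʲ,
∣B∣ < 2dLα₁ by the assumption (1.35)»; (1.31) p. 82: «(Ū₁ʲ)_b = V′_b = exp iB_b, if b ⊂ Λ_j (i.e., b₋, b₊ ∈ Λ_j) … where the configuration B is defined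
by the above equations», with p. 82 «Let us denote V(Ū₀ʲ)⁻¹ = V′» and p. 81 «If both end-points b₋, b₊ of a bond b belong to Λ_j, then the expression on
the left-hand side of (1.30) is equal to (Ū₁ʲ)_b by (92) of [3]»; [Balaban1985Averaging] (90)–(91) p. 31: «U̿₁ = \overline{\overline{R(U₀)U₁}},
U̿₁^{j+1} = \overline{\overline{R(Ū₀^j)U̿₁^j}}»; (1.16) p. 78: «U = U′U₀».

THE READING (located; as in the companion module, (R-a)–(R-f), plus).  (R-g) B8's «Ū₁ʲ» in (1.30)–(1.31) is [3]'s double-bar average `U̿₁ʲ` of the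
PERTURBATION variable `U₁` relative to `U₀` (`B8Eq131Derivation` READING (a); b07 `dbavgCovIter L U₀ U₁ j`), and «U = U′U₀» is the bondwise product
with `U′` at the START frame — so for the tree's right chart `U_A^u = W·e^{Z}` (`Z` END-framed) the perturbation is `U′(b) = W(b)e^{Z(b)}W(b)⁻¹ =
e^{Ad_{W(b)}Z(b)}` (`relPert`, dictionary `relPert_mul_eq_vary`).  (R-h) At the pair every bond of `Λ_k` is interior and `V′ = V(Ū₀ᵏ)⁻¹ = 1`
((R-a), (R-b): `avgIter L W k = V`), hence `B = 0` and (1.37) reads `dbavgCovIter L W (relPert W Z) k = 1`.  (R-i) B8's tangent space at `W` of its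
gauge-fixed surface `Σ_k` (p. 81) is typed as `slicB8 L N k W` := skew ∧ `(N·L^k)`-periodic ∧ `IsLandauB8 L N k W ·` ((1.38)) ∧ `QbarIter L k W · = 0`
(the linearisation of (1.37)'s constraint, in the tree's reading of [Balaban1985Averaging] (120)); that `QbarIter` IS the derivative of
`dbavgCovIter L W (relPert W ·) k` at `0` is NOT proved here (R24 (ii) business).

CONTENT (0 sorry): §1 `relPert`, `relPert_mul_eq_vary`, `relPert_zero`, `dbavgCovIter_one_right`, `structure LandauRepB8Avg` (`LandauRepB8` + `dbar`),
**`def PairLandauGaugeB8Avg d 𝒞 L N b g s₁ s₂ β dom`**, `toPair`, `perPair`, `pairLandauGaugeB8Avg_flat`; §2 `slicB8`, `mem_slicB8_iff`,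
`skew_of_mem_slicB8`, `periodic_of_mem_slicB8`.

HONEST FRAMING.  Typed hypothesis SHAPES and a dictionary; NOTHING of Bałaban's is proved; `PairLandauGaugeB8Avg 4 (sfClass 4 L N ε) …` for the
minimisers is [B8] Thm 2 ∘ [B11] Thm 1 READ at the pair ((R-a)–(R-i) ours), NOT proved anywhere in the tree; the chart supplier on `slicB8`, (P♮) there
([Balaban1985BackgroundPropagators] Thm 3.3 TYPE) and (RES♯) there are OPEN (census R24∕R25); the covariant root and **NE3 are NOT proved**; spine
PROVED 0∕9; finite T⁴ rung (B)+1 — NOT infinite volume, NOT mass gap, NOT `BetaPertH`, NOT Clay.  ABSOLUTE RULE kept: no printed sentence is a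
hypothesis of a theorem.  PLACEMENT: `Summits/QuantumFields/BalabanUV/T4Continuum/Spine/NE3/`; imports accepted modules only; moves nothing.  HONEST
DEPENDENCY: continuum YM on T⁴ ⇐ BetaPertH ∧ nine spine estimates (0/9 proved); BetaPertH ⇐ (D1) ∧ (D4) ∧ CAP+tail; G-an2-4 gates asym, D1 and NE2/3/4.
-/

set_option autoImplicit false

open scoped BigOperators Matrix Matrix.Norms.L2Operator
open NormedSpace Finset

namespace Summit.QuantumFields.BalabanUV.T4Continuum.NE3.PairLandauB8Avg

open Set
open Literature.MathematicalPhysics.QuantumFieldTheory.Balaban1983to89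
open B7Prop1Explicit B7Prop2Explicit
open T4AveragingDeficitWall hiding Site Plane Plaq Bond
open T4AveragingDeficitWallBoundary (IsPeriodicCfg periodBox)
open AveragingDeficitPeriodicCounting (IsPeriodicDir)
open AveragingDeficitChartCalculus (cavg)
open MinimalActionSandwich (IsMinimiser)
open MinimalActionRate (Regular)
open MinimalActionWitness (flatCfg flatClass)
open NE3EnergyShapes (residualScale residualScale_nonneg IsUnitarySite IsPeriodicSite gaugeAct_one rescale_bavg_flatCfg)
open NE3EnergyWeightedShapes (energyNormW CurlPairedResidual)
open NE3EnergyWeightedCovShape (NE3EnergyRateWCov)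
open NE3CovariantCalculus (hsR hsR_comm cD cDstar)
open NE3LandauOrbit (hsR_zero_left)
open BlockAveragePushDirGauge (gaugeDir)
open NE3CovariantBlockMean (bmeanIterW)
open NE3SlicePoincareShape (SlicePoincare)
open NE3EndpointChart (EndpointChart)
open NE3EnergyRateWSupOfSlicePoincare (cLambda)
open NE3EnergyRateWCovOfEndpointChart (ne3EnergyRateWCov_of_endpointChart_slice)
open NE3.PairLandauB8

open B7Eq92Concrete (Rc Rc_apply expUnit_conj tHol Fcov wframe tild dbavgCov dbavgCovIter dbavgCovIter_succ)
open NE3TangentCovariantTower (QbarIter)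

noncomputable section

variable {d : ℕ} {n : Type*} [Fintype n] [DecidableEq n]

/-! ## §1 (1.37) at the pair: the left-chart perturbation and the double-bar average of the representative -/

/-- **THE LEFT-CHART PERTURBATION OF THE REPRESENTATIVE**: `relPert W Z (b) = e^{Ad_{W(b)} Z(b)}` — B8's variable «U′» of (1.16) «U = U′U₀» for the
tree's right chart `U = W·e^{Z}` (`Z` END-framed): `U′(b) = W(b) e^{Z(b)} W(b)⁻¹`, a unit at the START frame of the bond (reading (R-c)).  A DATA
definition. [folklore] -/
def relPert (W : Site d → Fin d → (Matrix n n ℂ)ˣ) (Z : Site d → Fin d → Matrix n n ℂ) : Site d → Fin d → (Matrix n n ℂ)ˣ :=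
  fun x μ => expUnit (Ad (W x μ) (Z x μ))

/-- **DICTIONARY (R-c)**: «U′U₀» IS `W·e^{Z}` — bondwise `relPert W Z (b) · W(b) = vary W Z 1 (b)` ([Balaban1985Averaging] (57) `exp(XAX⁻¹) = R(X) exp A`,
`B7Eq92Concrete.expUnit_conj`). [folklore] -/
theorem relPert_mul_eq_vary (W : Site d → Fin d → (Matrix n n ℂ)ˣ) (Z : Site d → Fin d → Matrix n n ℂ) :
    (fun x μ => relPert W Z x μ * W x μ) = vary W Z 1 := by
  funext x μ
  have h : relPert W Z x μ = Rc (W x μ) (expUnit (Z x μ)) := by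
    unfold relPert Ad
    exact expUnit_conj (W x μ) (Z x μ)
  rw [h, Rc_apply, inv_mul_cancel_right]
  unfold vary
  rw [Complex.ofReal_one, one_smul]

/-- The perturbation of the zero direction is trivial: `relPert W 0 = 1`. [folklore] -/
@[simp] theorem relPert_zero (W : Site d → Fin d → (Matrix n n ℂ)ˣ) :
    relPert W (fun (_ : Site d) (_ : Fin d) => (0 : Matrix n n ℂ)) = 1 := by
  funext x μ
  apply Units.ext
  simp [relPert, Ad]

/-- **THE DOUBLE-BAR AVERAGE OF THE TRIVIAL PERTURBATION IS TRIVIAL**: `dbavgCovIter L U₀ 1 j = 1` for every background `U₀` and every order `j`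
((89)–(91) with `V₁ = 1`: the twisted transports `tHol U₀ 1` are `1`, the block frames `wframe L U₀ 1` are `1`, `tild L U₀ 1 = 1`). [folklore] -/
theorem dbavgCovIter_one_right (L : ℕ) : ∀ (j : ℕ) (U₀ : Site d → Fin d → (Matrix n n ℂ)ˣ),
    dbavgCovIter L U₀ (1 : Site d → Fin d → (Matrix n n ℂ)ˣ) j = 1
  | 0, _ => rfl
  | j + 1, U₀ => by
    funext z κ
    rw [dbavgCovIter_succ, dbavgCovIter_one_right L j U₀]
    have htHol : ∀ (V₀ : Site d → Fin d → (Matrix n n ℂ)ˣ) (y : Site d) (w : List (Letter d)),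
        tHol V₀ (1 : Site d → Fin d → (Matrix n n ℂ)ˣ) y w = 1 := by
      intro V₀ y w
      unfold tHol
      rw [one_mul, mul_inv_cancel]
    have hw : ∀ (V₀ : Site d → Fin d → (Matrix n n ℂ)ˣ) (y : Site d), wframe L V₀ (1 : Site d → Fin d → (Matrix n n ℂ)ˣ) y = 1 := by
      intro V₀ y
      unfold wframe Fcov
      apply Units.ext
      simp [htHol]
    have ht : ∀ (V₀ : Site d → Fin d → (Matrix n n ℂ)ˣ) (q : Site d) (κ : Fin d), tild L V₀ (1 : Site d → Fin d → (Matrix n n ℂ)ˣ) q κ = 1 := by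
      intro V₀ q κ
      unfold tild
      rw [one_mul, mul_inv_cancel]
    unfold dbavgCov
    rw [hw, hw, ht, inv_one, one_mul, one_mul, map_one]
    rfl

/-- **THE B8 LANDAU REPRESENTATIVE WITH (1.37)** — `LandauRepB8` PLUS the clause «Q_k(U₀, ηA) = B on Λ_k» of [Balaban1985RegularSpaces] (1.37) p. 82 READ
at the pair: by (1.31) p. 82 «(Ū₁ʲ)_b = V′_b, V′ = V(Ū₀ʲ)⁻¹» and reading (R-b) (`Ū₀ᵏ = avgIter L W k = V`), `B = 0`, i.e. the k-th order double-bar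
average ([Balaban1985Averaging] (89)–(91)) of the perturbation `U′ = relPert W Z` relative to `W` is trivial: `dbavgCovIter L W (relPert W Z) k = 1`
— the NON-LINEAR double-bar fibre equation whose linearisation makes the defect of `Z` from B8's tangent slice quadratic (census R24 (i); the route-Π
analogue is `NE3ResidualSliceRep.cavgIter_vary_eq_of_residualSliceRep`).  A hypothesis SHAPE, asserted for nothing. [folklore] -/
@[folklore]
structure LandauRepB8Avg (L N k : ℕ) (W UA : Site d → Fin d → (Matrix n n ℂ)ˣ) (u : Site d → (Matrix n n ℂ)ˣ)
    (Z : Site d → Fin d → Matrix n n ℂ) (s₁ s₂ β : ℝ) : Prop extends LandauRepB8 L N k W UA u Z s₁ s₂ β where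
  /-- (1.37) with `B = 0` at the pair: the k-th order double-bar average of `U′ = e^{Ad_W Z}` relative to `W` is `1` -/
  dbar : dbavgCovIter L W (relPert W Z) k = 1

variable (d) in
/-- **`PairLandauGaugeB8Avg` — [Balaban1985RegularSpaces] THEOREM 2 READ AT THE MINIMISER PAIR, WITH (1.37)**: `PairLandauGaugeB8` with the per-pair body
`LandauRepB8Avg` (all four printed conclusions (1.36)–(1.39) at `j = k`, (1.39) by its `D*D` member).  A hypothesis SHAPE, asserted for no class here
except the flat one below. [folklore] -/
@[folklore]
def PairLandauGaugeB8Avg (𝒞 : ℕ → Set (Site d → Fin d → (Matrix n n ℂ)ˣ)) (L N : ℕ) (b g s₁ s₂ β : ℝ)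
    (dom : Set (Site d → Fin d → (Matrix n n ℂ)ˣ)) : Prop :=
  ∀ k : ℕ, 1 ≤ k → ∀ V ∈ dom, ∀ UA UB : Site d → Fin d → (Matrix n n ℂ)ˣ,
    IsMinimiser d 𝒞 L N k V UA → IsMinimiser d 𝒞 L N (k + 1) V UB → Regular d L N b g (k + 1) UB →
      ∃ (u : Site d → (Matrix n n ℂ)ˣ) (Z : Site d → Fin d → Matrix n n ℂ),
        LandauRepB8Avg L N k (rescale L (bavg L UB)) UA u Z s₁ s₂ β

/-- Dropping (1.37) recovers `PairLandauGaugeB8`. [folklore] -/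
theorem PairLandauGaugeB8Avg.toPair {𝒞 : ℕ → Set (Site d → Fin d → (Matrix n n ℂ)ˣ)} {L N : ℕ} {b g s₁ s₂ β : ℝ}
    {dom : Set (Site d → Fin d → (Matrix n n ℂ)ˣ)} (h : PairLandauGaugeB8Avg d 𝒞 L N b g s₁ s₂ β dom) :
    PairLandauGaugeB8 d 𝒞 L N b g s₁ s₂ β dom := by
  intro k hk V hV UA UB hA hB hreg
  obtain ⟨u, Z, hZ⟩ := h k hk V hV UA UB hA hB hreg
  exact ⟨u, Z, hZ.toLandauRepB8⟩

/-- The per-pair body with (1.37), at one level ∕ datum ∕ pair. [folklore] -/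
theorem PairLandauGaugeB8Avg.perPair {𝒞 : ℕ → Set (Site d → Fin d → (Matrix n n ℂ)ˣ)} {L N : ℕ} {b g s₁ s₂ β : ℝ}
    {dom : Set (Site d → Fin d → (Matrix n n ℂ)ˣ)} (h : PairLandauGaugeB8Avg d 𝒞 L N b g s₁ s₂ β dom)
    {k : ℕ} (hk : 1 ≤ k) {V : Site d → Fin d → (Matrix n n ℂ)ˣ} (hV : V ∈ dom) {UA UB : Site d → Fin d → (Matrix n n ℂ)ˣ}
    (hA : IsMinimiser d 𝒞 L N k V UA) (hB : IsMinimiser d 𝒞 L N (k + 1) V UB) (hreg : Regular d L N b g (k + 1) UB) :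
    ∃ (u : Site d → (Matrix n n ℂ)ˣ) (Z : Site d → Fin d → Matrix n n ℂ), LandauRepB8Avg L N k (rescale L (bavg L UB)) UA u Z s₁ s₂ β :=
  h k hk V hV UA UB hA hB hreg

/-- **NON-VACUITY WITH (1.37)**: in the flat class with the flat datum the shape holds for every `s₁, s₂ ≥ 0` and every `β` (`u = 1`, `Z = 0`,
`relPert W 0 = 1`, `dbavgCovIter_one_right`). [folklore] -/
theorem pairLandauGaugeB8Avg_flat [Nonempty n] (L N : ℕ) (b g β : ℝ) {s₁ s₂ : ℝ} (hs₁ : 0 ≤ s₁) (hs₂ : 0 ≤ s₂) :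
    PairLandauGaugeB8Avg d (flatClass (n := n)) L N b g s₁ s₂ β {flatCfg} := by
  intro k _ V _ UA UB hA hB _
  have hUA : UA = flatCfg := by simpa [flatClass, MinimalActionSandwich.admissible] using hA.mem.1
  have hUB : UB = flatCfg := by simpa [flatClass, MinimalActionSandwich.admissible] using hB.mem.1
  have hξ : 0 ≤ ((L : ℝ)⁻¹) ^ k := pow_nonneg (inv_nonneg.mpr (Nat.cast_nonneg L)) k
  refine ⟨fun _ => 1, fun (_ : Site d) (_ : Fin d) => (0 : Matrix n n ℂ), ?_⟩
  exact
    { unitary := fun _ => (unitaryUnits _).one_mem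
      periodic := fun _ _ => rfl
      skew := fun _ _ => (skewAdjoint _).zero_mem
      per := fun _ _ _ => rfl
      rep := by rw [hUA, hUB, rescale_bavg_flatCfg, gaugeAct_one, vary_zero_dir]
      landau := isLandauB8_zero L N k _
      sup := fun x κ => by rw [norm_zero]; exact mul_nonneg hs₁ hξ
      grad := fun κ x μ => by
        simp only [Ad, mul_zero, zero_mul, sub_zero, norm_zero]
        exact mul_nonneg hs₁ (pow_nonneg hξ 2)
      holder := fun κ μ y => by
        simp only [Ad, mul_zero, zero_mul, sub_zero, norm_zero]
        exact mul_nonneg hs₂ (Real.rpow_nonneg hξ _)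
      lap := fun x κ => by
        rw [covLapDir_zero]
        simp only [norm_zero]
        exact mul_nonneg hs₁ (pow_nonneg hξ 3)
      dbar := by rw [relPert_zero, dbavgCovIter_one_right] }

/-! ## §2 B8's tangent slice -/

/-- **B8's TANGENT SLICE `T_B8(W)` IN THE TREE'S VOCABULARY** (level `k`, period `N·L^k`): the skew, `(N·L^k)`-periodic directions `Y` that are Landau
relative to `W` in the sense of (1.38) (`IsLandauB8 L N k W Y`) AND lie in the kernel of the k-fold LINEARISED DOUBLE-BAR AVERAGE `QbarIter L k W`
(`NE3TangentCovariantTower.QbarIter`, [Balaban1985Averaging] (120) — the linearisation of (1.37)'s constraint).  The direction set on which R24's chart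
supplier is to produce `NE3ProductPathChartSlice.DecomposedRepT` and on which (P♮) is the printed TYPE [Balaban1985BackgroundPropagators] Thm 3.3
(census R25).  A DATA definition (a `Set`); nothing is asserted about it here beyond the structural lemmas below. [folklore] -/
def slicB8 (L N k : ℕ) (W : Site d → Fin d → (Matrix n n ℂ)ˣ) : Set (Site d → Fin d → Matrix n n ℂ) :=
  {Y | IsSkewDir Y ∧ IsPeriodicDir Y ((N * L ^ k : ℕ) : ℤ) ∧ IsLandauB8 (d := d) L N k W Y ∧
    QbarIter L k W Y = fun _ _ => 0}

/-- Membership in `T_B8(W)`, unfolded. [folklore] -/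
theorem mem_slicB8_iff {L N k : ℕ} {W : Site d → Fin d → (Matrix n n ℂ)ˣ} {Y : Site d → Fin d → Matrix n n ℂ} :
    Y ∈ slicB8 (d := d) (n := n) L N k W ↔
      IsSkewDir Y ∧ IsPeriodicDir Y ((N * L ^ k : ℕ) : ℤ) ∧ IsLandauB8 (d := d) L N k W Y ∧ QbarIter L k W Y = fun _ _ => 0 :=
  Iff.rfl

/-- Members of `T_B8(W)` are skew (the junction's `hskewT`). [folklore] -/
theorem skew_of_mem_slicB8 {L N k : ℕ} {W : Site d → Fin d → (Matrix n n ℂ)ˣ} {Y : Site d → Fin d → Matrix n n ℂ}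
    (hY : Y ∈ slicB8 (d := d) (n := n) L N k W) : IsSkewDir Y :=
  hY.1

/-- Members of `T_B8(W)` are `(N·L^k)`-periodic (the junction's `hperT`). [folklore] -/
theorem periodic_of_mem_slicB8 {L N k : ℕ} {W : Site d → Fin d → (Matrix n n ℂ)ˣ} {Y : Site d → Fin d → Matrix n n ℂ}
    (hY : Y ∈ slicB8 (d := d) (n := n) L N k W) : IsPeriodicDir Y ((N * L ^ k : ℕ) : ℤ) :=
  hY.2.1

end

end Summit.QuantumFields.BalabanUV.T4Continuum.NE3.PairLandauB8Avg
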